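import Summits.HubbardSuperconductivity.HubbardSuperconductivity.Theorems.BalabanIRBirComplexStableXYCubicTable
import Literature.Analysis.Complex.ZeroFreeGrowthRigidity

/-!
# Negative lemma for `BalabanIR.BirComplexStableXY` (stmt-HubbardSuperconductivity-2080) modulo `CubicModulusCrossing`

Prover seat c4-0 on the glue item stmt-HubbardSuperconductivity-2082 (`BirGappedPhaseReduction :=
BirComplexStableXY → BirGroundStateAverageLRO`, decided by this negative lane), 2026-08-16.

The Beraha–Kahane–Weiss refutation of the typed engine, CLOSED MODULO A MODULUS CROSSING in the CUBIC Berry family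
`cubicTab ε₂ ζ = spatialTab + 1 • temporalCosTab + (iε₂) • temporalSinTab + (iζ) • temporalSin3Tab` of
`Theorems/BalabanIRBirComplexStableXYCubicTable.lean` (admissible for the crux with `r = 2`, `B = 1024`, `c₀ = 1/24`
on `|ε₂| ≤ 1/5`, `|Re ζ| ≤ 1/4`, `|Im ζ| ≤ 1/32`: `cubicTab_admissible`; `Z` entire in `ζ`:
`differentiable_partZ_cubic`).  Unlike the stiffness coordinate `a` of `StiffModulusCrossing` (whose 0↔1 sector
crossing is degenerate at leading semiclassical order, see the module docstring of the table file), the real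
`ζ`-diameter carries ≥ 5 charge-sector crossings at LEADING order (`q⋆(ζ) = K′ε₂ − (ε₂ + 24 Re ζ)/2 + O(1/K′)`).

* `CubicModulusCrossing` (hypothesis H_cubic): the `StiffModulusCrossing` shape for this family — a ball in the
  complex `ζ`-plane inside the admissible rectangle, a holomorphic normaliser `lam` bounded below, DOMINANCE
  `‖Z_M(ζ)/lam(ζ)^M − 1‖ ≤ 1/2` on a sub-ball for all large `M`, and exponential OUTGROWTH of `lam` at one point of the
  ball along a subsequence.  Intended reading: `lam` = Kato branch of the dominant sector eigenvalue at a real `ζ_A`,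
  outgrown at a real `ζ_B` several crossings away.
* `BirComplexStableXY_false_of_CubicModulusCrossing : CubicModulusCrossing → ¬ BirComplexStableXY`: conjunct 1 of the
  crux makes `Z_M/lam^M` zero-free holomorphic on the ball, `norm_partZ_le_exp_of_normA_le` gives exponential growth
  control, and `Literature.Analysis.Complex.not_frequently_exp_mul_le_norm_of_zeroFree` (zero-free holomorphic families
  keep their exponential growth rate: holomorphic logarithm, Borel–Carathéodory, Hadamard three circles) contradicts
  the outgrowth.

What H_cubic still needs (not constructible in the tree today): sector-resolved `K → ∞` spectral asymptotics, at FIXED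
`L`, of the slice transfer operator (self-adjoint on `L²((ℝ/2π)^{L²})` for real `ζ` by time reflection) to precision
`O(1) · 1/(K′a)` — one sector spacing, no longer `1e-4` of it — plus Kato continuation of the simple dominant eigenvalue
to a small complex `ζ`-ball.
-/

namespace Summit.HubbardSuperconductivity.BirComplexStableXYNegative

open scoped BigOperators Topology
open MeasureTheory Metric Filter Literature.Probability.LatticeModels

noncomputable section

/-! ### Hypothesis H_cubic (modulus crossing in the cubic family) and the negative lemma -/

/-- HYPOTHESIS H_cubic — MODULUS CROSSING in the cubic Berry coordinate `ζ`.  For every `K₀, L₀` there are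
`K ≥ K₀`, `L ≥ L₀`, a real Berry parameter `|ε₂| ≤ 1/5`, a ball `ball z₀ ρ` whose closure lies in the admissible
rectangle `|Re ζ| ≤ 1/4, |Im ζ| ≤ 1/32`, and a holomorphic normaliser `lam` on the ball with `‖lam‖ ≥ m > 0`
(intended: the Kato branch of the dominant charge-sector eigenvalue of the slice transfer operator at `z₀`), such that
(dominance) `‖Z_M(ζ)/lam(ζ)^M − 1‖ ≤ 1/2` on a smaller ball `ball z₀ r₀` for all large `M`, and
(crossing) at ONE point `z₁ ∈ ball z₀ ρ` the partition function outgrows `lam` exponentially along a subsequence.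
The leading-order sector count `q⋆(ζ) = K′ε₂ − (ε₂ + 24 Re ζ)/2 + O(1/K′)` puts ≥ 5 sector crossings on the
admissible real diameter, so `z₀, z₁` may be taken real and several crossings apart. -/
def CubicModulusCrossing : Prop :=
    ∀ (K₀ : ℝ) (L₀ : ℕ), ∃ K : ℝ, K₀ ≤ K ∧ ∃ (L : ℕ) (_ : NeZero L), L₀ ≤ L ∧
      ∃ ε₂ : ℝ, |ε₂| ≤ 1/5 ∧
      ∃ (z₀ : ℂ) (r₀ ρ : ℝ), 0 < r₀ ∧ r₀ < ρ ∧
        closedBall z₀ ρ ⊆ {z : ℂ | |z.re| ≤ 1/4 ∧ |z.im| ≤ 1/32} ∧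
        ∃ (lam : ℂ → ℂ) (m : ℝ), 0 < m ∧ DifferentiableOn ℂ lam (ball z₀ ρ) ∧
          (∀ z ∈ ball z₀ ρ, m ≤ ‖lam z‖) ∧
          (∃ M₁ : ℕ, ∀ M : ℕ, M₁ ≤ M → ∀ (_ : NeZero M), ∀ z ∈ ball z₀ r₀,
            ‖partZ K (cubicTab ε₂ z) L M / (lam z) ^ M - 1‖ ≤ 1/2) ∧
          ∃ z₁ ∈ ball z₀ ρ, ∃ η : ℝ, 0 < η ∧ ∀ M₁ : ℕ, ∃ M : ℕ, M₁ ≤ M ∧ ∃ (_ : NeZero M),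
            Real.exp (η * M) * ‖lam z₁‖ ^ M ≤ ‖partZ K (cubicTab ε₂ z₁) L M‖

/-- NEGATIVE LEMMA MODULO H_cubic: modulus crossing in the cubic Berry family refutes the crux
`BalabanIR.BirComplexStableXY` (stmt-HubbardSuperconductivity-2080).  Proof: instantiate the crux at
`r = 2, B = 1024, c₀ = 1/24`; by `cubicTab_admissible` every `ζ` in the ball is admissible, so conjunct 1 of the crux
makes `f_M(ζ) := Z_M(ζ)/lam(ζ)^M` ZERO-FREE and holomorphic on `ball z₀ ρ` for `M ≥ L`; the a-priori bound
`‖Z_M‖ ≤ e^{CM}` and `‖lam‖ ≥ m` give `‖f_M‖ ≤ e^{C'M}`; dominance gives `‖f_M − 1‖ ≤ 1/2` on `ball z₀ r₀`; the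
Literature lemma `Literature.Analysis.Complex.not_frequently_exp_mul_le_norm_of_zeroFree` (zero-free holomorphic
families cannot change their exponential growth rate inside a ball) contradicts the crossing at `z₁`.
[cite: BerahaKahaneWeiss1975, Theorem (necessity of (b))] -/
theorem BirComplexStableXY_false_of_CubicModulusCrossing :
    CubicModulusCrossing →
      ¬ Summit.HubbardSuperconductivity.HubbardSuperconductivity.Theses.BalabanIR.BirComplexStableXY := by
  intro hH h
  obtain ⟨K₀, L₀, hK⟩ := h 2 1024 (1/24) le_rfl (by norm_num)
  obtain ⟨K, hKK, L, hL, hL₀, ε₂, hε₂, z₀, r₀, ρ, hr₀, hr₀ρ, hrect, lam, m, hm, hlam, hlamm,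
    ⟨M₁, hdom⟩, z₁, hz₁, η, hη, hcross⟩ := hH K₀ L₀
  have hLpos : 0 < L := Nat.pos_of_ne_zero hL.ne
  set tab : ℂ → Table 2 := fun z => cubicTab ε₂ z with htab
  have hadm : ∀ z ∈ ball z₀ ρ, |z.re| ≤ 1/4 ∧ |z.im| ≤ 1/32 := fun z hz =>
    hrect (ball_subset_closedBall hz)
  -- conjunct 1 of the crux: no zeros on the ball for M ≥ L
  have hZne : ∀ (M : ℕ) [NeZero M], L ≤ M → ∀ z ∈ ball z₀ ρ, partZ K (tab z) L M ≠ 0 := by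
    intro M _ hLM z hz hZ
    obtain ⟨hU1, hN, hA, hC⟩ := cubicTab_admissible ε₂ z hε₂ (hadm z hz).1 (hadm z hz).2
    have key := hK K hKK (tab z) hU1 hN hA hC L M hL₀ hLM
    dsimp only at key
    dsimp only [partZ, action, genF, sh, cube] at hZ
    exact key.1 hZ
  -- the normalised family
  set f : ℕ → ℂ → ℂ := fun M z =>
    if hM : M = 0 then 1 else
      (haveI : NeZero M := ⟨hM⟩; partZ K (tab z) L M / (lam z) ^ M) with hf
  have hfM : ∀ (M : ℕ) [hM : NeZero M] (z : ℂ), f M z = partZ K (tab z) L M / (lam z) ^ M := by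
    intro M hM z
    simp only [hf, dif_neg hM.ne]
  have hlam0 : ∀ z ∈ ball z₀ ρ, lam z ≠ 0 := fun z hz h0 => by
    have := hlamm z hz; rw [h0, norm_zero] at this; linarith
  -- (i) holomorphy
  have hdiff : ∀ᶠ M in atTop, DifferentiableOn ℂ (f M) (ball z₀ ρ) := by
    filter_upwards [eventually_ge_atTop 1] with M hM
    haveI : NeZero M := ⟨by omega⟩
    have h1 : DifferentiableOn ℂ (fun z : ℂ => partZ K (tab z) L M) (ball z₀ ρ) :=
      (differentiable_partZ_cubic K ε₂ L M).differentiableOn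
    have h2 : DifferentiableOn ℂ (fun z : ℂ => (lam z) ^ M) (ball z₀ ρ) := hlam.pow M
    refine (h1.div h2 (fun z hz => pow_ne_zero M (hlam0 z hz))).congr ?_
    intro z _
    exact hfM M z
  -- (ii) no zeros
  have hne : ∀ᶠ M in atTop, ∀ z ∈ ball z₀ ρ, f M z ≠ 0 := by
    filter_upwards [eventually_ge_atTop L] with M hM
    haveI : NeZero M := ⟨by omega⟩
    intro z hz
    rw [hfM M z]
    exact div_ne_zero (hZne M hM z hz) (pow_ne_zero M (hlam0 z hz))
  -- (iii) exponential a-priori bound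
  set C₁ : ℝ := Fintype.card (TorusSite 2 L) * (1024 * |K| + Real.log (2 * Real.pi)) with hC₁
  have hbd : ∀ᶠ M in atTop, ∀ z ∈ ball z₀ ρ, ‖f M z‖ ≤ Real.exp ((C₁ - Real.log m) * M) := by
    filter_upwards [eventually_ge_atTop 1] with M hM
    haveI : NeZero M := ⟨by omega⟩
    intro z hz
    rw [hfM M z, norm_div, norm_pow]
    obtain ⟨_, _, hA, _⟩ := cubicTab_admissible ε₂ z hε₂ (hadm z hz).1 (hadm z hz).2
    have hZ : ‖partZ K (tab z) L M‖ ≤ Real.exp (C₁ * M) :=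
      norm_partZ_le_exp_of_normA_le K (tab z) hA L M
    have hlpos : 0 < ‖lam z‖ ^ M := pow_pos (lt_of_lt_of_le hm (hlamm z hz)) M
    rw [div_le_iff₀ hlpos]
    have hmM : Real.exp (Real.log m * M) ≤ ‖lam z‖ ^ M := by
      rw [mul_comm, Real.exp_nat_mul, Real.exp_log hm]
      exact pow_le_pow_left₀ hm.le (hlamm z hz) M
    calc ‖partZ K (tab z) L M‖ ≤ Real.exp (C₁ * M) := hZ
      _ = Real.exp ((C₁ - Real.log m) * M) * Real.exp (Real.log m * M) := by
          rw [← Real.exp_add]; ring_nf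
      _ ≤ Real.exp ((C₁ - Real.log m) * M) * ‖lam z‖ ^ M := by gcongr
  -- (iv) dominance on the small ball
  have hone : ∀ᶠ M in atTop, ∀ z ∈ ball z₀ r₀, ‖f M z - 1‖ ≤ 1/2 := by
    filter_upwards [eventually_ge_atTop (max M₁ 1)] with M hM
    haveI : NeZero M := ⟨by omega⟩
    intro z hz
    rw [hfM M z]
    exact hdom M (le_trans (le_max_left _ _) hM) inferInstance z hz
  -- the Literature lemma forbids exponential growth at z₁
  have hmain := Literature.Analysis.Complex.not_frequently_exp_mul_le_norm_of_zeroFree hr₀ hr₀ρ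
    hdiff hne hbd hone hz₁ hη
  apply hmain
  rw [Filter.frequently_atTop]
  intro M₂
  obtain ⟨M, hM, hMne, hineq⟩ := hcross M₂
  haveI : NeZero M := hMne
  refine ⟨M, hM, ?_⟩
  rw [hfM M z₁, norm_div, norm_pow]
  have hlpos : 0 < ‖lam z₁‖ ^ M := pow_pos (lt_of_lt_of_le hm (hlamm z₁ hz₁)) M
  rw [le_div_iff₀ hlpos]
  exact hineq

end

end Summit.HubbardSuperconductivity.BirComplexStableXYNegative
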